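import Literature.Geometry.Kaehler.CousinChartConvex
import Mathlib.Analysis.Normed.Module.HahnBanach
import HarnessLib

/-!
# Holomorphic interpolation at finitely many points

Two elementary existence statements used to identify the bottom (skyscraper) level of the
hyperplane-section tower in Serre's dimension count (GAGA n° 16 Lemme 8): the evaluation map
`𝒪(V) → ℂ^{Z ∩ V}` at a finite set of points is SURJECTIVE.

* `exists_differentiable_forall_eq` — on a complex normed space, for a finite set of points and
  arbitrary prescribed values there is an entire function (a polynomial in continuous linear
  functionals, Lagrange's formula with separating functionals from Hahn–Banach) taking these values;
* `exists_mdifferentiableOn_chartSet_forall_eq` — on a complex manifold, for a chart set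
  `W = chartSet 𝓘(ℝ, E) x₀ C` and a finite set of points of `W`, there is a function holomorphic on
  `W` with prescribed values at these points (read the entire interpolant in the chart).

Everything is proved; theorems only.

## References

* folklore (Lagrange interpolation); K. Fritzsche, H. Grauert, *From Holomorphic Functions to
  Complex Manifolds* (2002), Ch. I §1. [FritzscheGrauert2002]
-/

noncomputable section

open scoped Manifold ContDiff Topology
open Set Filter

namespace Literature.Geometry.Kaehler

variable {E : Type*} [NormedAddCommGroup E] [NormedSpace ℂ E]

/-- **Lagrange interpolation by an entire function** on a complex normed space: finitely many points,
arbitrary values. Induction on the finite set: to add a point `q`, correct by a multiple of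
`Π_{p} λ_p(· - p)` with functionals `λ_p(q - p) ≠ 0` (Hahn–Banach). [folklore] -/
theorem exists_differentiable_forall_eq (F : Finset E) (v : E → ℂ) :
    ∃ P : E → ℂ, Differentiable ℂ P ∧ ∀ p ∈ F, P p = v p := by
  classical
  induction F using Finset.induction_on with
  | empty => exact ⟨fun _ ↦ 0, differentiable_const 0, fun p hp ↦ absurd hp (Finset.notMem_empty p)⟩
  | @insert q F hq ih =>
    obtain ⟨P₀, hP₀, hP₀v⟩ := ih
    -- separating functionals
    have hsep : ∀ p ∈ F, ∃ g : E →L[ℂ] ℂ, g (q - p) ≠ 0 := fun p hp ↦ by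
      have hqp : q - p ≠ 0 := sub_ne_zero.2 fun h ↦ hq (h ▸ hp)
      obtain ⟨g, -, hg⟩ := exists_dual_vector ℂ (q - p) (norm_ne_zero_iff.2 hqp)
      refine ⟨g, ?_⟩
      rw [hg]
      exact Complex.ofReal_ne_zero.2 (norm_ne_zero_iff.2 hqp)
    choose! g hg using hsep
    set B : E → ℂ := fun e ↦ ∏ p ∈ F, g p (e - p) with hB
    have hBd : Differentiable ℂ B := fun e ↦
      (HasFDerivAt.finsetProd (u := F) (fun p _ ↦
        (((g p).differentiable.comp (differentiable_id.sub (differentiable_const p))) e).hasFDerivAt)).differentiableAt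
    have hBF : ∀ p ∈ F, B p = 0 := fun p hp ↦
      Finset.prod_eq_zero hp (by rw [sub_self, map_zero])
    have hBq : B q ≠ 0 := Finset.prod_ne_zero_iff.2 fun p hp ↦ hg p hp
    refine ⟨fun e ↦ P₀ e + (v q - P₀ q) / B q * B e, ?_, fun p hp ↦ ?_⟩
    · exact hP₀.add ((differentiable_const _).mul hBd)
    · rcases Finset.mem_insert.1 hp with rfl | hpF
      · show P₀ p + (v p - P₀ p) / B p * B p = v p
        rw [div_mul_cancel₀ _ hBq, add_sub_cancel]
      · show P₀ p + (v q - P₀ q) / B q * B p = v p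
        rw [hBF p hpF, mul_zero, add_zero, hP₀v p hpF]

variable [FiniteDimensional ℂ E] {M : Type*} [TopologicalSpace M] [ChartedSpace E M] [IsManifold 𝓘(ℂ, E) ω M]

omit [FiniteDimensional ℂ E] in
/-- **Holomorphic interpolation on a chart set of a complex manifold**: for finitely many points of
`W = chartSet 𝓘(ℝ, E) x₀ C` and arbitrary values there
is a function holomorphic on `W` taking these values (the entire interpolant at the chart images,
composed with the chart). [folklore] -/
theorem exists_mdifferentiableOn_chartSet_forall_eq (x₀ : M) {C : Set E} (F : Finset M) (hF : ∀ z ∈ F, z ∈ chartSet 𝓘(ℝ, E) x₀ C)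
    (v : M → ℂ) :
    ∃ f : M → ℂ, MDifferentiableOn 𝓘(ℂ, E) 𝓘(ℂ, ℂ) f (chartSet 𝓘(ℝ, E) x₀ C) ∧ ∀ z ∈ F, f z = v z := by
  classical
  set φ := extChartAt 𝓘(ℂ, E) x₀ with hφ
  obtain ⟨P, hP, hPv⟩ := exists_differentiable_forall_eq (F.image φ) (v ∘ φ.symm)
  refine ⟨fun z ↦ P (φ z), fun z hz ↦ ?_, fun z hz ↦ ?_⟩
  · have hxs : z ∈ (chartAt E x₀).source := by
      rw [← extChartAt_source 𝓘(ℂ, E)]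
      exact chartSet_subset_source 𝓘(ℝ, E) x₀ C hz
    have h1 : MDifferentiableAt 𝓘(ℂ, E) 𝓘(ℂ, ℂ) P (φ z) :=
      mdifferentiableAt_iff_differentiableAt.2 (hP _)
    have h2 : MDifferentiableAt 𝓘(ℂ, E) 𝓘(ℂ, E) φ z := mdifferentiableAt_extChartAt hxs
    exact (h1.comp z h2).mdifferentiableWithinAt
  · have hzs : z ∈ φ.source := chartSet_subset_source 𝓘(ℝ, E) x₀ C (hF z hz)
    have h := hPv (φ z) (Finset.mem_image_of_mem φ hz)
    simp only [Function.comp_apply, φ.left_inv hzs] at h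
    exact h

end Literature.Geometry.Kaehler

end
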